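import Mathlib
import Summits.Ventures.HodgeRepro.Tier4.Target
import Summits.Ventures.HodgeRepro.Tier4.Line3.Defs
import Summits.Ventures.HodgeRepro.Tier4.Line3.LocaliserS
import Summits.Ventures.HodgeRepro.Tier4.Line3.Majorant
import Summits.Ventures.HodgeRepro.Tier4.Line3.OffMainOrbit
import Summits.Ventures.HodgeRepro.Tier4.Line3.SylvesterTransfer
import Summits.Ventures.HodgeRepro.Tier4.Line3.DefiniteBound
import Summits.Ventures.HodgeRepro.Tier4.Line3.KernelBound
import Summits.Ventures.HodgeRepro.Tier4.Line3.ClassBoundLemmas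
import Summits.Ventures.HodgeRepro.Tier4.Line3.ClassBoundGauss
import Summits.Ventures.HodgeRepro.Tier4.Line3.ClassBound

/-!
# Tier4/Line3/ClassBoundDef — THE CLASS BOUND WITH THE DEFINITE GAUSSIANS KEPT (rung for L3.5; supersedes
`ClassBound.summand_bound_off_main` for the assembly of `term_dominated`)

Blind re-derivation cell `pub-hodge-repro`, Tier 4 «PROVE THE STEP» (README §9–§10), LINE L3, seat t4-L2-p3 on L3.5
`term_dominated` (lead S12234; S12794 self-reported defect of `OrbitPartition`).

`ClassBound.summand_bound_off_main` spends the WHOLE definite Gaussian `∏_k gaussDefAt c₀ (rep w k)` of `LocS.growth`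
(bounded by `1` in the `τ₀` case, used for the decay in the definite case), leaving the majorant `majorantAt` with the
half Gaussian at `τ₀` only.  For `d = [E : ℚ] > 2` that majorant is NOT summable over the support (`τ₀(L)` is dense in
`ℂ³` for a lattice `L ⊂ E³`; only the product of Gaussians at ALL places is summable over a lattice), so the residual of
the assembly must carry the definite Gaussians.  Here the same proof is run with `gaussDefAt c₀ = gaussDefAt (c₀/2)²`
(`gaussDefAt_add`): one half stays in the majorant

  `majorantDefAt c₁ Φ e w z = majorantAt Φ e w z · ∏_k gaussDefAt c₁ (rep w k)`   (`c₁ = c₀/2`),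

the other half pays the definite-place decay (`κ = min(π/2, c₁/(2K)) / D_max`, `C₁ = e^{κ D_max G₀}` as before):

  `‖summand D.Φ D.cf (ℓ.loc N) w z‖ ≤ B · majorantDefAt c₁ D.Φ e w z · C₁ · exp (−κ · (N(𝔭)^N)^{1/d})`

(`summand_bound_off_main_def`), with `c₁ > 0`, and `B, e, κ, C₁, c₁` independent of `N, w, z`.

Nothing here asserts anything about the truth of (P); HC_CM is NOT proved by anyone in this repository.
-/

set_option autoImplicit false

noncomputable section

namespace Summit.Ventures.HodgeRepro.Tier4.Line3

open Matrix NumberField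
open scoped ComplexConjugate

namespace T4Data

variable (X : T4Data)

/-- `gaussDefAt` is multiplicative in the constant: `gaussDefAt (a + b) x = gaussDefAt a x · gaussDefAt b x`. -/
theorem gaussDefAt_add (a b : ℝ) (x : Fin 3 → X.E) :
    X.gaussDefAt (a + b) x = X.gaussDefAt a x * X.gaussDefAt b x := by
  unfold gaussDefAt
  rw [← finprod_mul_distrib (Set.toFinite _) (Set.toFinite _)]
  refine finprod_congr fun σ => ?_
  classical
  simp only [finprod_eq_if]
  split_ifs
  · rw [← Real.exp_add]
    congr 1
    ring
  · rw [one_mul]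

/-- `gaussDefAt c₀ x = gaussDefAt (c₀/2) x ^ 2`. -/
theorem gaussDefAt_half (c₀ : ℝ) (x : Fin 3 → X.E) :
    X.gaussDefAt c₀ x = X.gaussDefAt (c₀ / 2) x * X.gaussDefAt (c₀ / 2) x := by
  rw [← X.gaussDefAt_add]
  congr 1
  ring

/-- The uniform majorant WITH the definite Gaussians: `majorantAt Φ e w z · ∏_k gaussDefAt c₁ (rep w k)`. -/
def majorantDefAt (c₁ : ℝ) (Φ : KMDatumS) (e : ℝ) (w : X.LineTuple) (z : Fin 2 → ℂ) : ℝ :=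
  X.majorantAt Φ e w z * ∏ k, X.gaussDefAt c₁ (X.rep w k)

/-- `0 ≤ majorantDefAt`. -/
theorem majorantDefAt_nonneg (c₁ : ℝ) (Φ : KMDatumS) (e : ℝ) (w : X.LineTuple) (z : Fin 2 → ℂ) :
    0 ≤ X.majorantDefAt c₁ Φ e w z :=
  mul_nonneg (X.majorantAt_nonneg _ _ _ _) (Finset.prod_nonneg fun _ _ => X.gaussDefAt_nonneg _ _)

/-- **THE CLASS BOUND WITH THE DEFINITE GAUSSIANS KEPT** (step 5 of LINE L3): for a localiser `ℓ : LocS` and the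
symmetric main tuple, every line tuple OFF the main orbit has its summand bounded, at every depth `N` and every
`z ∈ 𝔹`, by the uniform majorant `majorantDefAt c₁` (with the definite Gaussians) times
`C₁ · exp(−κ · (N(𝔭)^N)^{1/d})`, with `κ > 0`, `c₁ > 0` and `B, e, C₁` independent of `N`, `w`, `z`. -/
theorem summand_bound_off_main_def (D : X.ThetaData) (p : IsDedekindDomain.HeightOneSpectrum (RingOfIntegers X.E))
    (L₀ : Submodule (RingOfIntegers X.E) (Fin 3 → X.E)) (xm : X.Tuple)
    (h02 : xm 2 = xm 0) (h13 : xm 3 = xm 1) (hab : LinearIndependent X.E ![xm 0, xm 1]) (ℓ : X.LocS D p L₀ xm) :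
    ∃ (B e κ C₁ c₁ : ℝ), 0 < κ ∧ 0 ≤ B ∧ 0 ≤ C₁ ∧ 0 < c₁ ∧
      ∀ (N : ℕ) (w : X.LineTuple) (z : Fin 2 → ℂ), z ∈ ball →
      X.orbitOf w ≠ X.orbitOf (X.lines xm) →
      ‖X.summand D.Φ D.cf (ℓ.loc N) w z‖ ≤ B * X.majorantDefAt c₁ D.Φ e w z *
        (C₁ * Real.exp (-(κ * (((Ideal.absNorm p.asIdeal : ℝ) ^ N) ^ ((Module.finrank ℚ X.E : ℝ)⁻¹))))) := by
  classical
  obtain ⟨S, hS, hsupp⟩ := ℓ.supp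
  obtain ⟨B, e, c₀, hc₀, hgrowth⟩ := ℓ.growth
  obtain ⟨c₁, hc₁⟩ : ∃ c₁ : ℝ, c₁ = c₀ / 2 := ⟨_, rfl⟩
  have hc₁pos : 0 < c₁ := by rw [hc₁]; positivity
  have hSfg : ∀ L ∈ S, L.FG := fun L hL => (hS L hL).1.1
  obtain ⟨D₀, hD₀, hdev⟩ := X.exists_gram_dev_size p S hSfg xm h02 h13 hab
  have hdpos : 0 < Module.finrank ℚ X.E := Module.finrank_pos
  -- the constants, kept opaque
  obtain ⟨Dmax, hDmax_pos, hDmax_ge⟩ : ∃ Dmax : ℝ, 0 < Dmax ∧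
      ∀ σ : X.E →+* ℂ, ‖σ (algebraMap (RingOfIntegers X.E) X.E D₀)‖ ≤ Dmax := by
    refine ⟨∑ σ : X.E →+* ℂ, ‖σ (algebraMap (RingOfIntegers X.E) X.E D₀)‖, ?_, fun σ =>
      Finset.single_le_sum (f := fun σ : X.E →+* ℂ => ‖σ (algebraMap (RingOfIntegers X.E) X.E D₀)‖)
        (fun _ _ => norm_nonneg _) (Finset.mem_univ σ)⟩
    obtain ⟨σ₀⟩ : Nonempty (X.E →+* ℂ) := inferInstance
    have hD₀E : algebraMap (RingOfIntegers X.E) X.E D₀ ≠ 0 := by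
      intro h
      exact hD₀ ((map_eq_zero_iff _ (RingOfIntegers.coe_injective (K := X.E))).mp h)
    exact lt_of_lt_of_le (norm_pos_iff.mpr ((map_ne_zero σ₀).mpr hD₀E))
      (Finset.single_le_sum (f := fun σ : X.E →+* ℂ => ‖σ (algebraMap (RingOfIntegers X.E) X.E D₀)‖)
        (fun _ _ => norm_nonneg _) (Finset.mem_univ σ₀))
  obtain ⟨G₀, hG₀_ge⟩ : ∃ G₀ : ℝ, ∀ (σ : X.E →+* ℂ) (i j : Fin 4), ‖σ (X.gram xm i j)‖ ≤ G₀ := by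
    refine ⟨∑ σ : X.E →+* ℂ, ∑ i, ∑ j, ‖σ (X.gram xm i j)‖, fun σ i j => ?_⟩
    calc ‖σ (X.gram xm i j)‖ ≤ ∑ j, ‖σ (X.gram xm i j)‖ :=
          Finset.single_le_sum (f := fun j => ‖σ (X.gram xm i j)‖) (fun _ _ => norm_nonneg _) (Finset.mem_univ j)
      _ ≤ ∑ i, ∑ j, ‖σ (X.gram xm i j)‖ :=
          Finset.single_le_sum (f := fun i => ∑ j, ‖σ (X.gram xm i j)‖)
            (fun _ _ => Finset.sum_nonneg fun _ _ => norm_nonneg _) (Finset.mem_univ i)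
      _ ≤ ∑ σ : X.E →+* ℂ, ∑ i, ∑ j, ‖σ (X.gram xm i j)‖ :=
          Finset.single_le_sum (f := fun σ : X.E →+* ℂ => ∑ i, ∑ j, ‖σ (X.gram xm i j)‖)
            (fun _ _ => Finset.sum_nonneg fun _ _ => Finset.sum_nonneg fun _ _ => norm_nonneg _) (Finset.mem_univ σ)
  obtain ⟨K, hK_pos, hK_ge⟩ : ∃ K : ℝ, 0 < K ∧ ∀ σ : X.E →+* ℂ, ∑ k, ∑ l, ‖σ (X.H k l)‖ ≤ K := by
    refine ⟨∑ σ : X.E →+* ℂ, ∑ k, ∑ l, ‖σ (X.H k l)‖, ?_, fun σ =>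
      Finset.single_le_sum (f := fun σ : X.E →+* ℂ => ∑ k, ∑ l, ‖σ (X.H k l)‖)
        (fun _ _ => Finset.sum_nonneg fun _ _ => Finset.sum_nonneg fun _ _ => norm_nonneg _) (Finset.mem_univ σ)⟩
    obtain ⟨σ₀⟩ : Nonempty (X.E →+* ℂ) := inferInstance
    exact lt_of_lt_of_le (X.sum_norm_emb_H_pos σ₀)
      (Finset.single_le_sum (f := fun σ : X.E →+* ℂ => ∑ k, ∑ l, ‖σ (X.H k l)‖)
        (fun _ _ => Finset.sum_nonneg fun _ _ => Finset.sum_nonneg fun _ _ => norm_nonneg _) (Finset.mem_univ σ₀))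
  obtain ⟨κ₀, hκ₀_pos, hκ₀_le1, hκ₀_le2⟩ : ∃ κ₀ : ℝ, 0 < κ₀ ∧ κ₀ ≤ Real.pi / 2 ∧ κ₀ ≤ c₁ / (2 * K) :=
    ⟨min (Real.pi / 2) (c₁ / (2 * K)), lt_min (by positivity) (by positivity), min_le_left _ _, min_le_right _ _⟩
  refine ⟨max B 0, e, κ₀ / Dmax, Real.exp (κ₀ * G₀), c₁, by positivity, le_max_right _ _, (Real.exp_pos _).le,
    hc₁pos, ?_⟩
  intro N w z hz hne
  -- the trivial case: zero coefficient
  by_cases hc : X.coefQ D.cf (ℓ.loc N) (X.rep w) = 0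
  · unfold summand
    rw [hc, zero_mul, norm_zero]
    exact mul_nonneg (mul_nonneg (le_max_right _ _) (X.majorantDefAt_nonneg _ _ _ _ _))
      (mul_nonneg (Real.exp_pos _).le (Real.exp_pos _).le)
  obtain ⟨x, hx, L, hL, hball⟩ := hsupp N w hc
  have hball' : ∀ j, x j - xm j ∈ X.ballIdeal p N • L := by
    intro j
    have := hball j
    rwa [X.conjIdeal_eq_map_cR] at this
  have hne' : X.orbitOf (X.lines x) ≠ X.orbitOf (X.lines xm) := by rwa [hx]
  obtain ⟨i, j, σ, hσ⟩ := hdev N x L hL hball' hne'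
  -- the `d`-th root: `RN ≤ ‖σ D₀‖ ‖σ α‖`
  obtain ⟨RN, hRN⟩ : ∃ RN : ℝ, RN = ((Ideal.absNorm p.asIdeal : ℝ) ^ N) ^ ((Module.finrank ℚ X.E : ℝ)⁻¹) := ⟨_, rfl⟩
  obtain ⟨α, hα⟩ : ∃ α : X.E, α = X.gram x i j - X.gram xm i j := ⟨_, rfl⟩
  have hroot : RN ≤ ‖σ (algebraMap (RingOfIntegers X.E) X.E D₀)‖ * ‖σ α‖ := by
    have h1 : ((Ideal.absNorm p.asIdeal : ℝ) ^ N) ^ ((Module.finrank ℚ X.E : ℝ)⁻¹) ≤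
        ((‖σ (algebraMap (RingOfIntegers X.E) X.E D₀)‖ * ‖σ α‖) ^ Module.finrank ℚ X.E) ^
          ((Module.finrank ℚ X.E : ℝ)⁻¹) := by
      apply Real.rpow_le_rpow (by positivity) _ (by positivity)
      rw [mul_pow, hα]
      exact hσ
    rw [Real.pow_rpow_inv_natCast (by positivity) hdpos.ne'] at h1
    rw [hRN]
    exact h1
  have hα_ge : RN / Dmax ≤ ‖σ α‖ := by
    rw [div_le_iff₀ hDmax_pos]
    calc RN ≤ ‖σ (algebraMap (RingOfIntegers X.E) X.E D₀)‖ * ‖σ α‖ := hroot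
      _ ≤ Dmax * ‖σ α‖ := mul_le_mul_of_nonneg_right (hDmax_ge σ) (norm_nonneg _)
      _ = ‖σ α‖ * Dmax := mul_comm _ _
  -- the Gram entry of the ball representative is large at `σ`
  obtain ⟨R', hR'⟩ : ∃ R' : ℝ, R' = RN / Dmax - G₀ := ⟨_, rfl⟩
  have hgram_ge : R' ≤ ‖σ (X.gram x i j)‖ := by
    have h1 : ‖σ α‖ - ‖σ (X.gram xm i j)‖ ≤ ‖σ (X.gram x i j)‖ := by
      have := norm_sub_le (σ (X.gram x i j)) (σ (X.gram xm i j))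
      rw [← map_sub, ← hα] at this
      linarith
    linarith [hG₀_ge σ i j]
  -- the chosen representative is a unit multiple of the ball representative
  choose t ht hrep using fun k => X.rep_eq_smul_of_lines_eq hx k
  -- the two factors of the summand
  have hcoef := hgrowth N w
  have hker := X.norm_kernel_le D.Φ (X.rep w) z
  have ha0 : 0 ≤ aNorm D.Φ z 0 + aNorm D.Φ z 1 := add_nonneg (aNorm_nonneg _ _ _) (aNorm_nonneg _ _ _)
  -- the products of Gaussians
  obtain ⟨G, hG⟩ : ∃ G : ℝ, G = ∏ k, X.gaussDefAt c₁ (X.rep w k) := ⟨_, rfl⟩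
  have hGG : ∏ k, X.gaussDefAt c₀ (X.rep w k) = G * G := by
    rw [hG, ← Finset.prod_mul_distrib]
    refine Finset.prod_congr rfl fun k _ => ?_
    rw [hc₁]
    exact X.gaussDefAt_half c₀ _
  obtain ⟨Hf, hHf⟩ : ∃ Hf : ℝ, Hf = ∏ k, Real.exp (-(Real.pi / 2) * maj (X.ballCoord (X.rep w k)) z) := ⟨_, rfl⟩
  have hG0 : 0 ≤ G := by rw [hG]; exact Finset.prod_nonneg fun k _ => X.gaussDefAt_nonneg _ _
  have hG1 : G ≤ 1 := by
    rw [hG]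
    exact Finset.prod_le_one (fun k _ => X.gaussDefAt_nonneg _ _) fun k _ => X.gaussDefAt_le_one hc₁pos.le _
  have hHf0 : 0 ≤ Hf := by rw [hHf]; exact Finset.prod_nonneg fun k _ => (Real.exp_pos _).le
  have hHf1 : Hf ≤ 1 := by
    rw [hHf]
    refine Finset.prod_le_one (fun k _ => (Real.exp_pos _).le) fun k _ => ?_
    rw [Real.exp_le_one_iff]
    have h := maj_nonneg' (X.ballCoord (X.rep w k)) z hz
    have h' : 0 ≤ Real.pi / 2 * maj (X.ballCoord (X.rep w k)) z := by positivity
    linarith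
  -- the summand is bounded by `max B 0 · majorantAt · G · (G · Hf)`
  have hsplit : ‖X.summand D.Φ D.cf (ℓ.loc N) w z‖ ≤ max B 0 * X.majorantDefAt c₁ D.Φ e w z * (G * Hf) := by
    unfold summand
    rw [norm_mul]
    obtain ⟨P₁, hP₁⟩ : ∃ P₁ : ℝ, P₁ = ∏ k, (1 + ‖X.ballCoord (X.rep w k)‖) ^ e := ⟨_, rfl⟩
    obtain ⟨P₂, hP₂⟩ : ∃ P₂ : ℝ, P₂ = ∏ k, ((∑ i, ‖X.ballCoord (X.rep w k) i‖) ^ 2 *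
      Real.exp (-(Real.pi / 2) * maj (X.ballCoord (X.rep w k)) z)) := ⟨_, rfl⟩
    have hP₁0 : 0 ≤ P₁ := by rw [hP₁]; exact Finset.prod_nonneg fun k _ => Real.rpow_nonneg (by positivity) _
    have hcoef' : ‖X.coefQ D.cf (ℓ.loc N) (X.rep w)‖ ≤ max B 0 * (P₁ * (G * G)) := by
      refine hcoef.trans ?_
      rw [hP₁, ← hGG, ← Finset.prod_mul_distrib]
      exact mul_le_mul_of_nonneg_right (le_max_left _ _)
        (Finset.prod_nonneg fun k _ => mul_nonneg (Real.rpow_nonneg (by positivity) _) (X.gaussDefAt_nonneg _ _))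
    have hker' : ‖X.kernel D.Φ (X.rep w) z‖ ≤ (aNorm D.Φ z 0 + aNorm D.Φ z 1) ^ 4 * (P₂ * Hf) := by
      refine hker.trans (le_of_eq ?_)
      rw [hP₂, hHf, ← Finset.prod_mul_distrib]
      congr 1
      refine Finset.prod_congr rfl fun k _ => ?_
      rw [exp_neg_pi_eq_sq]
      ring
    have hmaj : X.majorantAt D.Φ e w z = (aNorm D.Φ z 0 + aNorm D.Φ z 1) ^ 4 * (P₁ * P₂) := by
      unfold majorantAt
      rw [hP₁, hP₂, Finset.prod_mul_distrib]
    calc ‖X.coefQ D.cf (ℓ.loc N) (X.rep w)‖ * ‖X.kernel D.Φ (X.rep w) z‖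
        ≤ (max B 0 * (P₁ * (G * G))) * ((aNorm D.Φ z 0 + aNorm D.Φ z 1) ^ 4 * (P₂ * Hf)) :=
          mul_le_mul hcoef' hker' (norm_nonneg _)
            (mul_nonneg (le_max_right _ _) (mul_nonneg hP₁0 (mul_nonneg hG0 hG0)))
      _ = max B 0 * X.majorantDefAt c₁ D.Φ e w z * (G * Hf) := by
          unfold majorantDefAt
          rw [hmaj, ← hG]
          ring
  -- the decay: `G * Hf ≤ exp (−κ₀ R')`
  have hdecay : G * Hf ≤ Real.exp (-(κ₀ * R')) := by
    rcases le_or_gt 0 R' with hR'0 | hR'0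
    · -- `R' ≥ 0`: one of the two Gaussian products decays
      by_cases hσtau : σ = X.τ₀ ∨ σ = conjEmb X.τ₀
      · -- the `τ₀` case: the kernel's half Gaussians
        have hnorm : R' ≤ ‖X.τ₀ (hform X.c X.H (X.rep w i) (X.rep w j))‖ := by
          rw [hrep i, hrep j, X.norm_emb_hform_smul_eq X.τ₀ (ht i) (ht j)]
          rcases hσtau with rfl | rfl
          · exact hgram_ge
          · rw [← X.norm_conjEmb_tau]
            exact hgram_ge
        have hJ : R' ≤ ‖star (X.ballCoord (X.rep w i)) ⬝ᵥ (J *ᵥ X.ballCoord (X.rep w j))‖ := by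
          rw [X.norm_ballCoord_J]
          exact hnorm
        have hHf' : Hf ≤ Real.exp (-(Real.pi / 2) * R') := by
          rw [hHf]
          refine prod_exp_half_le (fun k => maj_nonneg' (X.ballCoord (X.rep w k)) z hz) i j R'
            ⟨fun _ => ?_, fun hij => ?_⟩
          · have := rung_hform_le_maj (X.ballCoord (X.rep w i)) (X.ballCoord (X.rep w j)) z hz
            linarith
          · subst hij
            have h1 := rung_abs_le_maj (X.ballCoord (X.rep w i)) z hz
            -- `‖(y, y)_J‖ = |Re (y,y)_J|`: the form is real on the diagonal
            have hIm : (star (X.ballCoord (X.rep w i)) ⬝ᵥ (J *ᵥ X.ballCoord (X.rep w i))).im = 0 := by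
              simp [dotProduct, J, Matrix.mulVec_diagonal, Fin.sum_univ_three, Complex.mul_im, Complex.conj_re,
                Complex.conj_im]
              ring
            have hreal := Complex.abs_re_eq_norm.mpr hIm
            rw [← hreal] at hJ
            linarith
        calc G * Hf ≤ 1 * Real.exp (-(Real.pi / 2) * R') := mul_le_mul hG1 hHf' hHf0 zero_le_one
          _ = Real.exp (-(Real.pi / 2) * R') := one_mul _
          _ ≤ Real.exp (-(κ₀ * R')) := by
              apply Real.exp_le_exp.mpr
              have := mul_le_mul_of_nonneg_right hκ₀_le1 hR'0
              linarith
      · -- the definite case: the coefficient's definite Gaussians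
        rw [not_or] at hσtau
        have hσc : ∀ t, ‖σ (X.c t)‖ = ‖σ t‖ := fun t => by
          have h := IsCMField.complexEmbedding_complexConj X.E σ t
          rw [show σ (X.c t) = conj (σ t) from h, Complex.norm_conj]
        obtain ⟨Kσ, hKσ⟩ : ∃ Kσ : ℝ, Kσ = ∑ k, ∑ l, ‖σ (X.H k l)‖ := ⟨_, rfl⟩
        have hKσ_pos : 0 < Kσ := by rw [hKσ]; exact X.sum_norm_emb_H_pos σ
        have hKσ_le : Kσ ≤ K := by rw [hKσ]; exact hK_ge σ
        obtain ⟨Sx, hSx⟩ : ∃ Sx : Fin 4 → ℝ, Sx = fun k => ∑ i, ‖σ (x k i)‖ ^ 2 := ⟨_, rfl⟩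
        have hgS : ∀ k, X.gaussDefAt c₁ (X.rep w k) ≤ Real.exp (-(c₁ * Sx k)) := fun k => by
          rw [hrep k, X.gaussDefAt_smul c₁ (ht k), hSx]
          exact X.gaussDefAt_le_exp hc₁pos.le (x k) σ hσtau
        have hG' := prod_le_exp_two (g := fun k => X.gaussDefAt c₁ (X.rep w k)) (S := Sx) (c := c₁)
          (fun k => X.gaussDefAt_nonneg _ _) (fun k => X.gaussDefAt_le_one hc₁pos.le _) hgS i j
        rw [← hG] at hG'
        -- `Sx i + Sx j ≥ R' / Kσ`
        have hsum_ge : R' ≤ Kσ * (Sx i + Sx j) := by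
          have hform_le := norm_map_hform_le X.c X.H σ hσc (x i) (x j)
          rw [← hKσ] at hform_le
          have hSxi : Sx i = ∑ i', ‖σ (x i i')‖ ^ 2 := by rw [hSx]
          have hSxj : Sx j = ∑ l, ‖σ (x j l)‖ ^ 2 := by rw [hSx]
          rw [hSxi, hSxj]
          exact hgram_ge.trans hform_le
        have hGexp : G ≤ Real.exp (-(c₁ / (2 * Kσ) * R')) := by
          refine hG'.trans ?_
          have hc2 : 0 ≤ c₁ / (2 * Kσ) := by positivity
          by_cases hij : i = j
          · subst hij
            simp only [if_true]
            apply Real.exp_le_exp.mpr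
            -- `R' ≤ 2 Kσ · Sx i`, hence `c₁ / (2 Kσ) · R' ≤ c₁ · Sx i`
            have h2 : R' ≤ (2 * Kσ) * Sx i := by linarith
            have h3 : c₁ / (2 * Kσ) * R' ≤ c₁ * Sx i := by
              calc c₁ / (2 * Kσ) * R' ≤ c₁ / (2 * Kσ) * ((2 * Kσ) * Sx i) := mul_le_mul_of_nonneg_left h2 hc2
                _ = c₁ * Sx i := by field_simp
            linarith
          · simp only [hij, if_false]
            rw [← Real.exp_add]
            apply Real.exp_le_exp.mpr
            have h3 : c₁ / (2 * Kσ) * R' ≤ c₁ * Sx i + c₁ * Sx j := by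
              calc c₁ / (2 * Kσ) * R' ≤ c₁ / (2 * Kσ) * (Kσ * (Sx i + Sx j)) := mul_le_mul_of_nonneg_left hsum_ge hc2
                _ = c₁ * (Sx i + Sx j) / 2 := by field_simp
                _ ≤ c₁ * Sx i + c₁ * Sx j := by
                    have hSi : 0 ≤ Sx i := by rw [hSx]; exact Finset.sum_nonneg fun _ _ => sq_nonneg _
                    have hSj : 0 ≤ Sx j := by rw [hSx]; exact Finset.sum_nonneg fun _ _ => sq_nonneg _
                    nlinarith
            linarith
        calc G * Hf ≤ Real.exp (-(c₁ / (2 * Kσ) * R')) * 1 := mul_le_mul hGexp hHf1 hHf0 (Real.exp_pos _).le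
          _ = Real.exp (-(c₁ / (2 * Kσ) * R')) := mul_one _
          _ ≤ Real.exp (-(κ₀ * R')) := by
              apply Real.exp_le_exp.mpr
              have h2 : c₁ / (2 * K) ≤ c₁ / (2 * Kσ) :=
                div_le_div_of_nonneg_left hc₁pos.le (by positivity) (by linarith)
              have := mul_le_mul_of_nonneg_right (hκ₀_le2.trans h2) hR'0
              linarith
    · -- `R' < 0`: the trivial bound `G Hf ≤ 1 ≤ exp (−κ₀ R')`
      calc G * Hf ≤ 1 * 1 := mul_le_mul hG1 hHf1 hHf0 zero_le_one
        _ = 1 := one_mul 1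
        _ ≤ Real.exp (-(κ₀ * R')) := by
            rw [Real.one_le_exp_iff]
            nlinarith
  -- assemble
  have hexp : Real.exp (-(κ₀ * R')) = Real.exp (κ₀ * G₀) * Real.exp (-(κ₀ / Dmax * RN)) := by
    rw [← Real.exp_add, hR']
    congr 1
    ring
  calc ‖X.summand D.Φ D.cf (ℓ.loc N) w z‖ ≤ max B 0 * X.majorantDefAt c₁ D.Φ e w z * (G * Hf) := hsplit
    _ ≤ max B 0 * X.majorantDefAt c₁ D.Φ e w z * Real.exp (-(κ₀ * R')) :=
        mul_le_mul_of_nonneg_left hdecay (mul_nonneg (le_max_right _ _) (X.majorantDefAt_nonneg _ _ _ _ _))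
    _ = max B 0 * X.majorantDefAt c₁ D.Φ e w z * (Real.exp (κ₀ * G₀) * Real.exp (-(κ₀ / Dmax * RN))) := by
        rw [hexp]
    _ = max B 0 * X.majorantDefAt c₁ D.Φ e w z *
        (Real.exp (κ₀ * G₀) * Real.exp (-(κ₀ / Dmax *
          (((Ideal.absNorm p.asIdeal : ℝ) ^ N) ^ ((Module.finrank ℚ X.E : ℝ)⁻¹))))) := by rw [hRN]

end T4Data

end Summit.Ventures.HodgeRepro.Tier4.Line3

end
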